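import Mathlib
import HarnessLib
import Summits.CriticalPhenomena.CardyFormulaZ2.Theses.CardySelfRefinement
import Literature.Probability.RandomPlanarGeometry.ChordalReversibility
import Literature.Probability.RandomPlanarGeometry.ConformalRectangle
import Literature.Probability.RandomPlanarGeometry.IsometryCovariance
import Literature.Probability.RandomPlanarGeometry.CritPercSLELocalityItoProofs
import Literature.Probability.RandomPlanarGeometry.SLEUniquenessInLaw
import Literature.Probability.RandomPlanarGeometry.SLELawOneDomainReduction
import Literature.Probability.RandomPlanarGeometry.SLERestrictionLocal
import Literature.Probability.LatticeModels.FKIsingInterfaceSLEAssembly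

/-!
# Cardy's formula pins the SLE parameter: helpers for stub `stub_cardyPinsSLE6` (S5) of line
# `SketchIdeatorTwo`, crux `SymmetryUpgradeR` (stmt-CriticalPhenomena-17239, route CardySelfRefinement)

Two sorry-free END-OF-CHAIN pieces of S5 ("Cardy on all conformal rectangles + conformal covariance +
typed local-Markov bundle + clause (iv) ⇒ chordal SLE₆ law"):

* `cardyPinsSLE6_of_sleFamily` — **Cardy pins `κ` among SLE families**: a chordal family all of whose
  laws are chordal SLE_κ laws (`κ > 0`) and which satisfies Cardy's crossing formula on every conformal
  rectangle consists of SLE₆ laws. Proof: uniqueness in law of chordal SLE_κ (`IsSLELaw.unique'`,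
  Lawler 2005 §6.1) turns the family's Cardy identity into Cardy's identity for EVERY SLE_κ law of
  every rectangle, and the tree's locality characterisation at one `κ`
  (`eq_six_of_forall_measureReal_hitsBefore_at`: Werner 2007 §3 p. 19, Lawler 2005 Props. 6.8/6.33,
  every analytic input proved in `Literature`) gives `κ = 6`.
* `cardyPinsSLE6_of_drivingMartingale` — **Werner's end of the identification** (Werner 2007 §3.8;
  CDHKS 2014 §3): a conformally covariant chordal family whose law in ONE Dobrushin domain `D₀` is
  carried by curves driven (through a chordal uniformizing map `φ` of `D₀`) by a process `W` with
  `W/√6` a continuous local martingale of quadratic variation `t` is the chordal SLE₆ law in EVERY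
  Dobrushin domain: Lévy's characterisation + transport (`isSLELaw_of_isLocalMartingale_driving_through`,
  with the SLE₆ random curve through `φ` from Rohde–Schramm's Thm. 5.1/7.1 at `κ = 6 ≠ 8`, both theorems
  of the tree) identify `P D₀`, and the one-domain reduction
  (`ChordalFamily.IsConformallyCovariant.isSLELaw_of_isSLELaw`, Lawler 2005 §6.1) moves it to every `D`.

What remains of S5 after these two pieces is exactly the existence of such a driving martingale for the
limit family on one domain (Werner 2007 Lemmas 3.1–3.3 + §3.8 / Camia–Newman 2007 §§5–7 for the bond-ℤ²
limit of clause (iv)), recorded by the lead.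
-/

noncomputable section

namespace Summit.CriticalPhenomena.CardyFormulaZ2.Theorems.SymmetryUpgradeR.SwallowingSkeleton

open MeasureTheory Filter Set
open Literature.Probability.RandomPlanarGeometry Literature.Probability.LatticeModels
open Literature.Probability.Percolation hiding cardyFunction
open UpperHalfPlane (upperHalfPlaneSet)

/-- **Cardy pins `κ = 6` among SLE families.** If `κ > 0`, every `P D` is the chordal SLE_κ law of
`(D; a, b)`, and `P` satisfies Cardy's crossing formula on every conformal rectangle (the curve of
`P (R.chord 0 2)` from `a` to `c` in `(Ω; a, b, c, d)` hits `(cd)` before `(bc)` with probability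
`F(η)`), then every `P D` is the chordal SLE₆ law. Uniqueness in law of chordal SLE_κ
(`IsSLELaw.unique'`) makes the Cardy hypothesis a statement about all SLE_κ laws of all rectangles, and
`eq_six_of_forall_measureReal_hitsBefore_at` (Werner 2007 §3 p. 19; Lawler 2005 Props. 6.8, 6.33) gives
`κ = 6`. -/
theorem cardyPinsSLE6_of_sleFamily : ∀ (κ : NNReal) (P : ChordalFamily), 0 < κ → (∀ D : DobrushinDomain, IsSLELaw κ D (P D)) → (∀ (R : ConformalRectangle) (φ : ConformalEquiv upperHalfPlaneSet R.carrier) (x : Fin 4 → ℝ), R.IsUniformizing φ x → (P (R.chord 0 2 (by decide))).real (CurveClass.hitsBefore (R.arc 2) (R.arc 1)) = cardyFunction (crossRatio x)) → ∀ D : DobrushinDomain, IsSLELaw 6 D (P D) := by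
  intro κ P hκ hsle hcardy D
  have h6 : κ = 6 := by
    refine eq_six_of_forall_measureReal_hitsBefore_at hκ (fun D' => ?_) ?_
    · obtain ⟨Γ, hΓ, -⟩ := hsle D'
      exact ⟨Γ, hΓ⟩
    · intro R μ φ x hμ hφ
      rw [hμ.unique' (hsle _)]
      exact hcardy R φ x hφ
  subst h6
  exact hsle D

/-- **Werner's end of the identification of SLE₆** (Werner 2007 §3.8: "`w(t/6)` is a standard
one-dimensional Brownian motion, and `γ` is an SLE(6) process"; CDHKS 2014 §3). Let `P` be a
conformally covariant chordal family and suppose that in ONE Dobrushin domain `D₀`, with chordal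
uniformizing map `φ : ℍ → D₀`, the probability law `P D₀` carries a process
`W : CurveClass ℂ → ([0, ∞) → ℝ)` with measurable marginals, a.s. continuous paths, `W 0 = 0` a.s.,
such that `P D₀`-a.e. curve class `c` is driven by `W c` through `φ` (`Loewner.IsDrivenBy`) and
`W/√6` is a continuous local martingale with quadratic variation `t` for some filtration. Then every
`P D` is the chordal SLE₆ law: `isSLELaw_of_isLocalMartingale_driving_through` (Lévy's characterisation,
proved; the SLE₆ random curve through `φ` from `hasSLETrace_of_ne_eight_apply`,
`tendsto_norm_sleTrace_atTop_of_ne_eight`, `exists_isSLECurve_through_of_ae_tendsto` at `κ = 6 ≠ 8`)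
identifies `P D₀`, and conformal covariance transports it
(`ChordalFamily.IsConformallyCovariant.isSLELaw_of_isSLELaw`). -/
theorem cardyPinsSLE6_of_drivingMartingale : ∀ P : ChordalFamily, P.IsConformallyCovariant → (∃ (D₀ : DobrushinDomain) (φ : ConformalEquiv upperHalfPlaneSet D₀.carrier) (W : CurveClass ℂ → NNReal → ℝ) (𝓕 : Filtration NNReal (inferInstance : MeasurableSpace (CurveClass ℂ))), D₀.IsChordalUniformizing φ ∧ IsProbabilityMeasure (P D₀) ∧ (∀ t, Measurable fun c => W c t) ∧ (∀ᵐ c ∂(P D₀), W c 0 = 0) ∧ (∀ᵐ c ∂(P D₀), Continuous (W c)) ∧ IsLocalMartingale (fun t c => (Real.sqrt 6)⁻¹ * W c t) 𝓕 (P D₀) ∧ Literature.Probability.Process.HasQuadraticVariation (fun t c => (Real.sqrt 6)⁻¹ * W c t) (fun t _ => (t : ℝ)) 𝓕 (P D₀) ∧ ∀ᵐ c ∂(P D₀), Loewner.IsDrivenBy φ.boundaryExtension (D₀.pt 1) (W c) c) → ∀ D : DobrushinDomain, IsSLELaw 6 D (P D) := by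
  intro P hcov ⟨D₀, φ, W, 𝓕, hφ, hprob, hWm, h0, hc, hM, hQ, hdrv⟩ D
  have h6pos : (0 : NNReal) < 6 := by norm_num
  have h68 : (6 : NNReal) ≠ 8 := by norm_num
  have hκt : HasSLETrace 6 := hasSLETrace_of_ne_eight_apply h68
  obtain ⟨Γ, hΓm, hΓ⟩ := exists_isSLECurve_through_of_ae_tendsto hκt
    (tendsto_norm_sleTrace_atTop_of_ne_eight h6pos h68)
    JordanDomain.continuousOn_boundaryExtension_holds (aemeasurable_sleTrace_holds hκt) hφ
  haveI := hprob
  have hD₀ : IsSLELaw 6 D₀ (P D₀) :=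
    isSLELaw_of_isLocalMartingale_driving_through h6pos hΓm hΓ hφ hWm h0 hc hM hQ hdrv
  exact hcov.isSLELaw_of_isSLELaw hD₀ D

end Summit.CriticalPhenomena.CardyFormulaZ2.Theorems.SymmetryUpgradeR.SwallowingSkeleton
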